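import Mathlib
import HarnessLib
import Literature.MathematicalPhysics.StatisticalMechanics.RenormalisationMapLipschitzMaxGain
import Literature.MathematicalPhysics.StatisticalMechanics.ActivityExtension

/-!
# The renormalisation map on the `r`-ball: the Lipschitz constant `σ(r)` of [ABKM19] Ch. 12 (12.4)
# as a closed expression, and the zeroth-order bound (torus data)

`RenormalisationMapLipschitzMaxGain.weakNormLE_nextKStep_sub_abkm_max_gain` is stated with free radii
`b, C`, carriers `ω, κ` and side conditions coupling them to `‖H − H'‖_{k,0}` and `C_Δ`.  On the
`r`-ball of the fine tuning (`‖H‖_{k,0}, ‖H'‖_{k,0} ≤ r`, `‖K‖_k, ‖K'‖_k ≤ r`, `‖K − K'‖_k ≤ C_Δ ≤ 2r`) all of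
them follow from FOUR conditions on `(r, A)` alone, with the carriers
`v_r = C_{8.7}·rA_𝒫A^{−1}`, `ω(r) = 8e^{1/4}(2r + v_r) + 16e^{3/8}(4r + 2v_r)`,
`κ(r) = 1 + e^{1/4} + 16e^{3/8}(4r + 2v_r)`:

* `vABKM`, `omegaABKM`, `kappaABKM`, **`sigmaABKM d L R A A_𝒫 r`** — the explicit Lipschitz constant
  `σ(r) = Θ_H + Θ_K` at `b = C = r`, `ω = ω(r)`, `κ = κ(r)`; `sigmaABKM_nonneg`;
* `weakNormLE_trivAct`, `factorises_trivAct`, `transInv_trivAct`, `weakNormLE_sub_trivAct` — the origin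
  `𝟙_∅` of the `K`-coordinate satisfies the hypotheses of the Lipschitz estimate;
* **`weakNormLE_nextKStep_sub_abkm_ball`** — `‖S(H,K) − S(H',K')‖_{k+1} ≤ σ(r)·max(‖H−H'‖_{k,0}, C_Δ)` on
  the `r`-ball (the `lipschitz` field of `RGFlow.IsRGStepQ` for the concrete data);
* **`weakNormLE_nextKStep_abkm_ball`** — `‖S(H,K)‖_{k+1} ≤ σ(r)·r` on the `r`-ball (against
  `S(0, 𝟙_∅) = 𝟙_∅`, `nextKStep_zero_trivAct`).

Everything is proved; no named fact.

## References
* S. Adams, S. Buchholz, R. Kotecký, S. Müller, arXiv:1910.13564, Theorem 6.8, Ch. 12 (12.2)–(12.4)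
  [AdamsBuchholzKoteckyMuller2019].
-/

noncomputable section

namespace Literature.MathematicalPhysics.StatisticalMechanics.GradientRG

open scoped BigOperators Classical
open Finset MeasureTheory
open Literature.MathematicalPhysics.StatisticalMechanics.TorusPolymer
  (IsPolymer blocks polys bprod blockOf thicken reblock boxCorner mem_polys mem_blocks numBlocks isPolymer_blockOf
    card_blocks_eq_numBlocks blocks_blockOf empty_mem_polys closure mem_blockOf_self)
open Literature.Barriers.CriticalPhenomena.LongRangePhi4.Polymer (IsConn components)
open Literature.MathematicalPhysics.StatisticalMechanics.GradientFRD (iterDiff)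
open Literature.MathematicalPhysics.QuantumFieldTheory

variable {d M : ℕ} [NeZero M]

/-! ## The carriers and the Lipschitz constant on the `r`-ball -/

/-- `v_r = C_{8.7} · r · A_𝒫 · A^{−1}` (the size of `B_k K` for `‖K‖_k ≤ r`, Lemma 10.6).
[cite: AdamsBuchholzKoteckyMuller2019, Lemma 10.6] -/
def vABKM (d R : ℕ) (A A𝒫 r : ℝ) : ℝ := pi2BoundConst d (((2 * R + 2 : ℕ) : ℝ) + ((d / 2 + 1 : ℕ) : ℝ)) * (r * A𝒫 * A⁻¹)

/-- `ω(r) = 8e^{1/4}(2r + v_r) + 16e^{3/8}(4r + 2v_r)` — dominates the three smallness carriers of the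
Lipschitz estimate on the `r`-ball. [cite: AdamsBuchholzKoteckyMuller2019, Theorem 6.8 / Ch. 12 (12.4)] -/
def omegaABKM (d R : ℕ) (A A𝒫 r : ℝ) : ℝ :=
  8 * Real.exp (1 / 4) * (2 * r + vABKM d R A A𝒫 r) + 16 * Real.exp (3 / 8) * (4 * r + 2 * vABKM d R A A𝒫 r)

/-- `κ(r) = 1 + e^{1/4} + 16e^{3/8}(4r + 2v_r)` — dominates the block-product carriers of the Lipschitz
estimate on the `r`-ball. [cite: AdamsBuchholzKoteckyMuller2019, Theorem 6.8 / Ch. 12 (12.4)] -/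
def kappaABKM (d R : ℕ) (A A𝒫 r : ℝ) : ℝ :=
  1 + Real.exp (1 / 4) + 16 * Real.exp (3 / 8) * (4 * r + 2 * vABKM d R A A𝒫 r)

/-- **`σ(r)`** — the Lipschitz constant `Θ_H + Θ_K` of `weakNormLE_nextKStep_sub_abkm_max_gain` at
`b = C = r`, `ω = ω(r)`, `κ = κ(r)` (explicit; its leading term as `r → 0`, `A → ∞` is
`L^dA_𝒫·abkmContrConst d L R`). [cite: AdamsBuchholzKoteckyMuller2019, Ch. 12 (12.4)] -/
def sigmaABKM (d L R : ℕ) (A A𝒫 r : ℝ) : ℝ :=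
  (((0 : ℝ) * ((L : ℝ) ^ d * (A𝒫 * abkmContrConst d L R) + largePartEps d L A A𝒫 (1 + 1 / ((2 * (2 ^ d + 1) + 6 : ℝ) ^ d)) + largePartEps d L A A𝒫 (1 + 1 / ((2 * (2 ^ d + 1) + 6 : ℝ) ^ d))) +
        ((L ^ d : ℕ) : ℝ) * (kappaABKM d R A A𝒫 r) ^ (L ^ d) * ((16 * Real.exp (3 / 8) * (2 * (1 : ℝ) + pi2BoundConst d (((2 * R + 2 : ℕ) : ℝ) + ((d / 2 + 1 : ℕ) : ℝ)) * ((0 : ℝ) * A𝒫 * A⁻¹))) * (((1 + 8 * pi2BoundConst d (((2 * R + 2 : ℕ) : ℝ) + ((d / 2 + 1 : ℕ) : ℝ))) * (r * A𝒫 * A⁻¹)) + 256 * Real.exp (1 / 4) * ((A𝒫 + 4) * r ^ 2 + 2 * r * (pi2BoundConst d (((2 * R + 2 : ℕ) : ℝ) + ((d / 2 + 1 : ℕ) : ℝ)) * (r * A𝒫 * A⁻¹)) + (pi2BoundConst d (((2 * R + 2 : ℕ) : ℝ) + ((d / 2 + 1 : ℕ) : ℝ)) * (r * A𝒫 * A⁻¹))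 ^ 2)) + 16 * Real.exp (3 / 8) * (2 * r + pi2BoundConst d (((2 * R + 2 : ℕ) : ℝ) + ((d / 2 + 1 : ℕ) : ℝ)) * (r * A𝒫 * A⁻¹)) * ((1 + 8 * pi2BoundConst d (((2 * R + 2 : ℕ) : ℝ) + ((d / 2 + 1 : ℕ) : ℝ))) * ((0 : ℝ) * A𝒫 * A⁻¹)) + (512 * Real.exp (1 / 4) * (A𝒫 + 4) * (r + r) * (1 : ℝ) + 512 * Real.exp (1 / 4) * ((1 : ℝ) * (pi2BoundConst d (((2 * R + 2 : ℕ) : ℝ) + ((d / 2 + 1 : ℕ) : ℝ)) * (r * A𝒫 * A⁻¹)) + r * (pi2BoundConst d (((2 * R + 2 : ℕ) : ℝ) + ((d / 2 + 1 : ℕ) : ℝ)) * ((0 : ℝ) * A𝒫 * A⁻¹))) + 256 * Real.exp (1 / 4) * (3 * (pi2BoundConst d (((2 * R + 2 : ℕ) : ℝ) + ((d / 2 + 1 : ℕ) : ℝ)) * (r * A𝒫 * A⁻¹))) * (pi2BoundConst d (((2 * R + 2 : ℕ) : ℝ) + ((d / 2 + 1 : ℕ) : ℝ)) * ((0 : ℝ)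 * A𝒫 * A⁻¹)))) * A +
        (((3 * (16 * Real.exp (3 / 8) * (2 * (1 : ℝ) + pi2BoundConst d (((2 * R + 2 : ℕ) : ℝ) + ((d / 2 + 1 : ℕ) : ℝ)) * ((0 : ℝ) * A𝒫 * A⁻¹))) + 16 * Real.exp (3 / 8) * (1 : ℝ) + (0 : ℝ)) * ((omegaABKM d R A A𝒫 r) * A ^ 4)) + (2 * (16 * Real.exp (3 / 8) * (2 * (1 : ℝ) + pi2BoundConst d (((2 * R + 2 : ℕ) : ℝ) + ((d / 2 + 1 : ℕ) : ℝ)) * ((0 : ℝ) * A𝒫 * A⁻¹))) + (0 : ℝ)) * ((kappaABKM d R A A𝒫 r) ^ (L ^ d) * ((2 * (kappaABKM d R A A𝒫 r) * max 1 A𝒫) ^ ((2 ^ (d + 1) + 2) ^ d * L ^ d) * (2 : ℝ) ^ ((2 ^ (d + 1) + 2) ^ d * L ^ d)) * A ^ (-((1 + 1 / ((2 * (2 ^ d + 1) + 6 : ℝ) ^ d)) - 1) : ℝ))) + ((3 * (16 * Real.exp (3 / 8) * (2 * (1 : ℝ) + pi2BoundConst d (((2 * R + 2 : ℕ) : ℝ)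 + ((d / 2 + 1 : ℕ) : ℝ)) * ((0 : ℝ) * A𝒫 * A⁻¹))) + 16 * Real.exp (3 / 8) * (1 : ℝ) + (0 : ℝ)) * ((omegaABKM d R A A𝒫 r) * A ^ 4)) + ((3 * (16 * Real.exp (3 / 8) * (2 * (1 : ℝ) + pi2BoundConst d (((2 * R + 2 : ℕ) : ℝ) + ((d / 2 + 1 : ℕ) : ℝ)) * ((0 : ℝ) * A𝒫 * A⁻¹))) + 16 * Real.exp (3 / 8) * (1 : ℝ) + (0 : ℝ)) * ((omegaABKM d R A A𝒫 r) * A ^ 4))) +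
        ((1 : ℝ) * ((L : ℝ) ^ d * (A𝒫 * abkmContrConst d L R) + largePartEps d L A A𝒫 (1 + 1 / ((2 * (2 ^ d + 1) + 6 : ℝ) ^ d)) + largePartEps d L A A𝒫 (1 + 1 / ((2 * (2 ^ d + 1) + 6 : ℝ) ^ d))) +
        ((L ^ d : ℕ) : ℝ) * (kappaABKM d R A A𝒫 r) ^ (L ^ d) * ((16 * Real.exp (3 / 8) * (2 * (0 : ℝ) + pi2BoundConst d (((2 * R + 2 : ℕ) : ℝ) + ((d / 2 + 1 : ℕ) : ℝ)) * ((1 : ℝ) * A𝒫 * A⁻¹))) * (((1 + 8 * pi2BoundConst d (((2 * R + 2 : ℕ) : ℝ) + ((d / 2 + 1 : ℕ) : ℝ))) * (r * A𝒫 * A⁻¹)) + 256 * Real.exp (1 / 4) * ((A𝒫 + 4) * r ^ 2 + 2 * r * (pi2BoundConst d (((2 * R + 2 : ℕ) : ℝ) + ((d / 2 + 1 : ℕ) : ℝ)) * (r * A𝒫 * A⁻¹)) + (pi2BoundConst d (((2 * R + 2 : ℕ) : ℝ) + ((d / 2 + 1 : ℕ) : ℝ)) * (r * A𝒫 * A⁻¹))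 ^ 2)) + 16 * Real.exp (3 / 8) * (2 * r + pi2BoundConst d (((2 * R + 2 : ℕ) : ℝ) + ((d / 2 + 1 : ℕ) : ℝ)) * (r * A𝒫 * A⁻¹)) * ((1 + 8 * pi2BoundConst d (((2 * R + 2 : ℕ) : ℝ) + ((d / 2 + 1 : ℕ) : ℝ))) * ((1 : ℝ) * A𝒫 * A⁻¹)) + (512 * Real.exp (1 / 4) * (A𝒫 + 4) * (r + r) * (0 : ℝ) + 512 * Real.exp (1 / 4) * ((0 : ℝ) * (pi2BoundConst d (((2 * R + 2 : ℕ) : ℝ) + ((d / 2 + 1 : ℕ) : ℝ)) * (r * A𝒫 * A⁻¹)) + r * (pi2BoundConst d (((2 * R + 2 : ℕ) : ℝ) + ((d / 2 + 1 : ℕ) : ℝ)) * ((1 : ℝ) * A𝒫 * A⁻¹))) + 256 * Real.exp (1 / 4) * (3 * (pi2BoundConst d (((2 * R + 2 : ℕ) : ℝ) + ((d / 2 + 1 : ℕ) : ℝ)) * (r * A𝒫 * A⁻¹))) * (pi2BoundConst d (((2 * R + 2 : ℕ) : ℝ) + ((d / 2 + 1 : ℕ) : ℝ)) * ((1 : ℝ)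 * A𝒫 * A⁻¹)))) * A +
        (((3 * (16 * Real.exp (3 / 8) * (2 * (0 : ℝ) + pi2BoundConst d (((2 * R + 2 : ℕ) : ℝ) + ((d / 2 + 1 : ℕ) : ℝ)) * ((1 : ℝ) * A𝒫 * A⁻¹))) + 16 * Real.exp (3 / 8) * (0 : ℝ) + (1 : ℝ)) * ((omegaABKM d R A A𝒫 r) * A ^ 4)) + (2 * (16 * Real.exp (3 / 8) * (2 * (0 : ℝ) + pi2BoundConst d (((2 * R + 2 : ℕ) : ℝ) + ((d / 2 + 1 : ℕ) : ℝ)) * ((1 : ℝ) * A𝒫 * A⁻¹))) + (1 : ℝ)) * ((kappaABKM d R A A𝒫 r) ^ (L ^ d) * ((2 * (kappaABKM d R A A𝒫 r) * max 1 A𝒫) ^ ((2 ^ (d + 1) + 2) ^ d * L ^ d) * (2 : ℝ) ^ ((2 ^ (d + 1) + 2) ^ d * L ^ d)) * A ^ (-((1 + 1 / ((2 * (2 ^ d + 1) + 6 : ℝ) ^ d)) - 1) : ℝ))) + ((3 * (16 * Real.exp (3 / 8) * (2 * (0 : ℝ) + pi2BoundConst d (((2 * R + 2 : ℕ) : ℝ)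 + ((d / 2 + 1 : ℕ) : ℝ)) * ((1 : ℝ) * A𝒫 * A⁻¹))) + 16 * Real.exp (3 / 8) * (0 : ℝ) + (1 : ℝ)) * ((omegaABKM d R A A𝒫 r) * A ^ 4)) + ((3 * (16 * Real.exp (3 / 8) * (2 * (0 : ℝ) + pi2BoundConst d (((2 * R + 2 : ℕ) : ℝ) + ((d / 2 + 1 : ℕ) : ℝ)) * ((1 : ℝ) * A𝒫 * A⁻¹))) + 16 * Real.exp (3 / 8) * (0 : ℝ) + (1 : ℝ)) * ((omegaABKM d R A A𝒫 r) * A ^ 4))))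


/-- `σ(r) ≥ 0` (`r ≥ 0`, `A ≥ 1`, `A_𝒫 ≥ 0`, `L ≥ 1`). [cite: AdamsBuchholzKoteckyMuller2019, Ch. 12 (12.4)] -/
theorem sigmaABKM_nonneg {L R : ℕ} {A A𝒫 r : ℝ} (hL : 0 < L) (hA1 : 1 ≤ A) (hA𝒫 : 0 ≤ A𝒫) (hr : 0 ≤ r) :
    0 ≤ sigmaABKM d L R A A𝒫 r := by
  have hA0 : 0 < A := by linarith
  have hL0 : (0 : ℝ) < L := by exact_mod_cast hL
  have hcc0 : 0 ≤ abkmContrConst d L R := by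
    unfold abkmContrConst
    exact mul_nonneg (by norm_num) (blockContrConst_nonneg d one_pos (scaleRatio_pos hL).le zero_le_one hL0 hL0
      (scaleRatio_pos hL).le (Nat.cast_nonneg _) (by positivity))
  have hε0 : 0 ≤ largePartEps d L A A𝒫 (1 + 1 / ((2 * (2 ^ d + 1) + 6 : ℝ) ^ d)) := largePartEps_nonneg d L hA0.le hA𝒫
  have hC87_0 : 0 ≤ pi2BoundConst d (((2 * R + 2 : ℕ) : ℝ) + ((d / 2 + 1 : ℕ) : ℝ)) := pi2BoundConst_nonneg d (by positivity)
  unfold sigmaABKM omegaABKM kappaABKM vABKM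
  positivity

/-! ## The origin `𝟙_∅` of the `K`-coordinate -/

/-- `‖𝟙_∅‖_k^{(A)} ≤ C` for every `C ≥ 0` (`𝟙_∅` vanishes on non-empty polymers; `A > 0`).
[cite: AdamsBuchholzKoteckyMuller2019, Ch. 6.4 (6.50)] -/
theorem weakNormLE_trivAct {P : NormParams d M} (hA : 0 < P.A) (k : ℕ) {C : ℝ} (hC : 0 ≤ C) :
    WeakNormLE P k trivAct C := by
  have h0 : WeakNormLE P k trivAct 0 := by
    intro X hX hc
    have hXne : X ≠ ∅ := Finset.nonempty_iff_ne_empty.1 hc.1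
    have : trivAct X = fun _ : (Fin d → ZMod M) → ℝ => (0 : ℂ) := by
      funext φ; rw [trivAct_apply]; unfold TorusPolymer.punit; rw [if_neg hXne]
    rw [this]
    exact WeakNormLE.zero X hX hc
  exact h0.mono hA hC

/-- `𝟙_∅` factorises on every scale `s ≥ 1` (`= mulExt 0`). [cite: AdamsBuchholzKoteckyMuller2019, Lemma 6.4 (5)] -/
theorem factorises_trivAct {s : ℕ} (hs : 1 ≤ s) :
    Factorises s (trivAct : Finset (Fin d → ZMod M) → ((Fin d → ZMod M) → ℝ) → ℂ) := by
  rw [← mulExt_zero]; exact factorises_mulExt hs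

omit [NeZero M] in
/-- `𝟙_∅` is translation invariant on every scale. [cite: AdamsBuchholzKoteckyMuller2019, Lemma 6.4 (1)] -/
theorem transInv_trivAct (s : ℕ) :
    TransInv s (trivAct : Finset (Fin d → ZMod M) → ((Fin d → ZMod M) → ℝ) → ℂ) := by
  rw [← mulExt_zero]; exact transInv_mulExt fun _ _ _ _ => rfl

/-- `𝟙_∅(X, ·)` is constant, hence `C^n`. [cite: AdamsBuchholzKoteckyMuller2019, Ch. 6.2] -/
theorem contDiff_trivAct (n : ℕ) (X : Finset (Fin d → ZMod M)) :
    ContDiff ℝ n ((trivAct : Finset (Fin d → ZMod M) → ((Fin d → ZMod M) → ℝ) → ℂ) X) :=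
  contDiff_const

/-- `𝟙_∅(X, ·)` is constant, hence gauge-local. [cite: AdamsBuchholzKoteckyMuller2019, Ch. 6.2] -/
theorem isGaugeLocal_trivAct {V : Type*} [NormedAddCommGroup V] [NormedSpace ℝ V]
    (T : ((Fin d → ZMod M) → ℝ) →ₗ[ℝ] V) (X : Finset (Fin d → ZMod M)) :
    IsGaugeLocal T ((trivAct : Finset (Fin d → ZMod M) → ((Fin d → ZMod M) → ℝ) → ℂ) X) :=
  IsGaugeLocal.const _ _

/-- `‖K − 𝟙_∅‖_k ≤ C` when `‖K‖_k ≤ C` (they agree on non-empty polymers).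
[cite: AdamsBuchholzKoteckyMuller2019, Ch. 6.4 (6.50)] -/
theorem weakNormLE_sub_trivAct {P : NormParams d M} {k : ℕ}
    {K : Finset (Fin d → ZMod M) → ((Fin d → ZMod M) → ℝ) → ℂ} {C : ℝ} (hK : WeakNormLE P k K C) :
    WeakNormLE P k (K - trivAct) C := by
  intro X hX hc
  have hXne : X ≠ ∅ := Finset.nonempty_iff_ne_empty.1 hc.1
  have : (K - trivAct : Finset (Fin d → ZMod M) → ((Fin d → ZMod M) → ℝ) → ℂ) X = K X := by
    funext φ; rw [Pi.sub_apply, Pi.sub_apply, trivAct_apply]; unfold TorusPolymer.punit; rw [if_neg hXne, sub_zero]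
  rw [this]
  exact hK X hX hc

/-! ## The Lipschitz estimate on the `r`-ball -/

set_option maxHeartbeats 400000 in
/-- **`‖S(H,K) − S(H',K')‖_{k+1}^{(A)} ≤ σ(r)·max(‖H−H'‖_{k,0}, C_Δ)` on the `r`-ball** (module docstring):
`‖H‖_{k,0}, ‖H'‖_{k,0} ≤ r ≤ 1/64`, `‖K‖_k, ‖K'‖_k ≤ r`, `‖K − K'‖_k ≤ C_Δ ≤ 2r`, and the four
conditions `v_r ≤ 1/64`, `ω(r)A² ≤ 1`, `κ(r)^{L^d}c₃ ≤ A^{η−1}`, `κ(r)^{L^d}c₂ ≤ A^{η−1}`.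
[cite: AdamsBuchholzKoteckyMuller2019, Theorem 6.8 / Ch. 12 (12.4)] -/
theorem weakNormLE_nextKStep_sub_abkm_ball {L N Mord R n p r₀ : ℕ} {θbar lam μ δ₁ δ₀ A𝒫 h A : ℝ}
    {𝒞 : ℕ → (Fin d → ZMod M) → ℝ} (hd : 3 ≤ d) (hn : 2 ≤ n) (hLodd : Odd L) (hL : 2 ^ (d + 3) + 16 * R ≤ L)
    (hR2 : 2 ≤ R) (hM : M = L ^ N) {k : ℕ} (hkN : k + 1 ≤ N)
    (hp : d / 2 + 2 ≤ p) (hpM : p + d ≤ Mord) (hMR : Mord ≤ R) (hr₀ : 3 ≤ r₀)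
    (hθbar : 0 < θbar) (hlam : 0 < lam)
    (hB : AbkmWeightBounds L N Mord R n θbar lam μ δ₁ δ₀ A𝒫 𝒞
      (abkmWeightData L N Mord R θbar (schedDelta δ₀ δ₁ N) 𝒞))
    (hδ₀ : 0 < δ₀) (hδ₁ : 0 < δ₁) (hh : 0 < h) (hh0 : hZeroSq d R δ₀ δ₁ ≤ h ^ 2)
    {Cα : (Fin d → ℕ) → ℝ}
    (hCα : ∀ j, 1 ≤ j → j ≤ N + 1 → ∀ θ' : Fin d → ℕ, ∑ i, θ' i ≤ n →
      ∀ x, |iterDiff θ' (𝒞 j) x| ≤ Cα θ' / (L : ℝ) ^ ((j - 1) * (d - 2 + ∑ i, θ' i)))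
    (hh2 : secondDiffConst Cα ≤ h ^ 2) (hA𝒫 : 0 ≤ A𝒫) (hA1 : 1 ≤ A)
    (hA𝒫A : A𝒫 ≤ A)
    (hsmall : (2 : ℝ) ^ (L ^ d) * (A𝒫 * A ^ (-(1 - (1 + 1 / ((2 * (2 ^ d + 1) + 6 : ℝ) ^ d))⁻¹) : ℝ)) ≤ 1)
    (D : StepData d M) (hDs : D.s = L ^ k) (hDL : D.L = L) (hD𝒞 : D.𝒞 = 𝒞 (k + 1))
    {x₀ : Fin d → ZMod M} (hB₀ : D.B₀ = blockOf (L ^ k) x₀) (hc₀ : D.c₀ = boxCorner (L ^ k) (starRad R L d k) x₀)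
    {H H' : RelevantHamiltonian ℂ d} {r : ℝ}
    (hH : hamNorm (fieldWt h (L : ℝ) d k) ((L : ℝ) ^ k) (L ^ (d * k)) H ≤ r) (hH' : hamNorm (fieldWt h (L : ℝ) d k) ((L : ℝ) ^ k) (L ^ (d * k)) H' ≤ r) (hr : r ≤ 1 / 64)
    {K K' : Finset (Fin d → ZMod M) → ((Fin d → ZMod M) → ℝ) → ℂ} {CΔ : ℝ} (hCΔ : 0 ≤ CΔ)
    (hK : WeakNormLE (abkmNormParams L N Mord R p r₀ h θbar A (schedDelta δ₀ δ₁ N) 𝒞) k K r) (hK' : WeakNormLE (abkmNormParams L N Mord R p r₀ h θbar A (schedDelta δ₀ δ₁ N) 𝒞) k K' r)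
    (hΔ : WeakNormLE (abkmNormParams L N Mord R p r₀ h θbar A (schedDelta δ₀ δ₁ N) 𝒞) k (K - K') CΔ) (hCΔ2 : CΔ ≤ 2 * r)
    (hKfac : Factorises (L ^ k) K) (hK0 : ∀ φ, K ∅ φ = 1) (hK'fac : Factorises (L ^ k) K') (hK'0 : ∀ φ, K' ∅ φ = 1)
    (hKd : ∀ Y, ContDiff ℝ r₀ (K Y)) (hK'd : ∀ Y, ContDiff ℝ r₀ (K' Y))
    (hKloc : ∀ Y, IsPolymer (L ^ k) Y → IsConn Y → IsGaugeLocal ((abkmNormParams L N Mord R p r₀ h θbar A (schedDelta δ₀ δ₁ N) 𝒞).gauge k Y) (K Y))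
    (hK'loc : ∀ Y, IsPolymer (L ^ k) Y → IsConn Y → IsGaugeLocal ((abkmNormParams L N Mord R p r₀ h θbar A (schedDelta δ₀ δ₁ N) 𝒞).gauge k Y) (K' Y))
    (hKt : TransInv (L ^ k) K) (hK't : TransInv (L ^ k) K')
    (hv : vABKM d R A A𝒫 r ≤ 1 / 64) (hωA : omegaABKM d R A A𝒫 r * A ^ 2 ≤ 1)
    (hc3A : (kappaABKM d R A A𝒫 r) ^ (L ^ d) * ((2 * (2 * (kappaABKM d R A A𝒫 r) * max 1 A𝒫)) ^ ((2 ^ (d + 1) + 2) ^ d * L ^ d) * (4 : ℝ) ^ ((2 ^ (d + 1) + 2) ^ d * L ^ d)) ≤ A ^ ((1 + 1 / ((2 * (2 ^ d + 1) + 6 : ℝ) ^ d)) - 1 : ℝ))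
    (hc2A : (kappaABKM d R A A𝒫 r) ^ (L ^ d) * ((2 * (kappaABKM d R A A𝒫 r) * max 1 A𝒫) ^ ((2 ^ (d + 1) + 2) ^ d * L ^ d) * (2 : ℝ) ^ ((2 ^ (d + 1) + 2) ^ d * L ^ d)) ≤ A ^ ((1 + 1 / ((2 * (2 ^ d + 1) + 6 : ℝ) ^ d)) - 1 : ℝ)) :
    WeakNormLE (abkmNormParams L N Mord R p r₀ h θbar A (schedDelta δ₀ δ₁ N) 𝒞) (k + 1) (fun U φ => nextKStep D H K U φ - nextKStep D H' K' U φ)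
      (sigmaABKM d L R A A𝒫 r * max (hamNorm (fieldWt h (L : ℝ) d k) ((L : ℝ) ^ k) (L ^ (d * k)) (H - H')) CΔ) := by
  have hL0 : (0 : ℝ) < L := by exact_mod_cast hLodd.pos
  have hA0 : 0 < A := by linarith
  have h𝔥 : 0 < fieldWt h (L : ℝ) d k := fieldWt_pos hh hL0 d k
  have hRk : (0 : ℝ) < (L : ℝ) ^ k := by positivity
  have hnn : ∀ G : RelevantHamiltonian ℂ d, 0 ≤ hamNorm (fieldWt h (L : ℝ) d k) ((L : ℝ) ^ k) (L ^ (d * k)) G := fun G => hamNorm_nonneg h𝔥.le hRk.le _ _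
  have hr0 : 0 ≤ r := (hnn H).trans hH
  have hC87_0 : 0 ≤ pi2BoundConst d (((2 * R + 2 : ℕ) : ℝ) + ((d / 2 + 1 : ℕ) : ℝ)) := pi2BoundConst_nonneg d (by positivity)
  have hAinv : 0 ≤ A⁻¹ := inv_nonneg.2 hA0.le
  have hv0 : 0 ≤ pi2BoundConst d (((2 * R + 2 : ℕ) : ℝ) + ((d / 2 + 1 : ℕ) : ℝ)) * (r * A𝒫 * A⁻¹) := by positivity
  have he14 : 1 ≤ Real.exp (1 / 4) := Real.one_le_exp (by norm_num)
  have he38 : 0 ≤ 16 * Real.exp (3 / 8) := by positivity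
  -- `‖H − H'‖ ≤ 2r`
  have hx : hamNorm (fieldWt h (L : ℝ) d k) ((L : ℝ) ^ k) (L ^ (d * k)) (H - H') ≤ 2 * r := by
    have e := hamNorm_add_le h𝔥.le hRk.le (L ^ (d * k)) H (-H')
    rw [← sub_eq_add_neg, hamNorm_neg] at e
    linarith [e, hH, hH']
  have hx0 := hnn (H - H')
  -- `v_Δ ≤ 2 v_r`
  have hvΔ : pi2BoundConst d (((2 * R + 2 : ℕ) : ℝ) + ((d / 2 + 1 : ℕ) : ℝ)) * (CΔ * A𝒫 * A⁻¹) ≤ 2 * (pi2BoundConst d (((2 * R + 2 : ℕ) : ℝ) + ((d / 2 + 1 : ℕ) : ℝ)) * (r * A𝒫 * A⁻¹)) := by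
    have e := mul_le_mul_of_nonneg_left (mul_le_mul_of_nonneg_right (mul_le_mul_of_nonneg_right hCΔ2 hA𝒫) hAinv) hC87_0
    calc pi2BoundConst d (((2 * R + 2 : ℕ) : ℝ) + ((d / 2 + 1 : ℕ) : ℝ)) * (CΔ * A𝒫 * A⁻¹) ≤ pi2BoundConst d (((2 * R + 2 : ℕ) : ℝ) + ((d / 2 + 1 : ℕ) : ℝ)) * (2 * r * A𝒫 * A⁻¹) := e
      _ = 2 * (pi2BoundConst d (((2 * R + 2 : ℕ) : ℝ) + ((d / 2 + 1 : ℕ) : ℝ)) * (r * A𝒫 * A⁻¹)) := by ring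
  have hv' : pi2BoundConst d (((2 * R + 2 : ℕ) : ℝ) + ((d / 2 + 1 : ℕ) : ℝ)) * (r * A𝒫 * A⁻¹) ≤ 1 / 64 := hv
  have e1 : 2 * hamNorm (fieldWt h (L : ℝ) d k) ((L : ℝ) ^ k) (L ^ (d * k)) (H - H') + pi2BoundConst d (((2 * R + 2 : ℕ) : ℝ) + ((d / 2 + 1 : ℕ) : ℝ)) * (CΔ * A𝒫 * A⁻¹) ≤ 4 * r + 2 * (pi2BoundConst d (((2 * R + 2 : ℕ) : ℝ) + ((d / 2 + 1 : ℕ) : ℝ)) * (r * A𝒫 * A⁻¹)) := by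
    linarith [hx, hvΔ]
  have e2 := mul_le_mul_of_nonneg_left e1 he38
  have e3 : 2 * r + pi2BoundConst d (((2 * R + 2 : ℕ) : ℝ) + ((d / 2 + 1 : ℕ) : ℝ)) * (r * A𝒫 * A⁻¹) ≤ 4 * r + 2 * (pi2BoundConst d (((2 * R + 2 : ℕ) : ℝ) + ((d / 2 + 1 : ℕ) : ℝ)) * (r * A𝒫 * A⁻¹)) := by linarith [hr0, hv0]
  have e4 := mul_le_mul_of_nonneg_left e3 he38
  have e5 := mul_le_mul_of_nonneg_left hx he38
  have e6 : 16 * r ≤ 8 * Real.exp (1 / 4) * (2 * r + pi2BoundConst d (((2 * R + 2 : ℕ) : ℝ) + ((d / 2 + 1 : ℕ) : ℝ)) * (r * A𝒫 * A⁻¹)) := by nlinarith [he14, hr0, hv0]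
  have hω1 : 8 * Real.exp (1 / 4) * (2 * r + pi2BoundConst d (((2 * R + 2 : ℕ) : ℝ) + ((d / 2 + 1 : ℕ) : ℝ)) * (r * A𝒫 * A⁻¹)) + 16 * Real.exp (3 / 8) * (2 * hamNorm (fieldWt h (L : ℝ) d k) ((L : ℝ) ^ k) (L ^ (d * k)) (H - H') + pi2BoundConst d (((2 * R + 2 : ℕ) : ℝ) + ((d / 2 + 1 : ℕ) : ℝ)) * (CΔ * A𝒫 * A⁻¹)) ≤ omegaABKM d R A A𝒫 r := by
    unfold omegaABKM vABKM; linarith [e2]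
  have hω2 : 8 * Real.exp (1 / 4) * r + 16 * Real.exp (3 / 8) * hamNorm (fieldWt h (L : ℝ) d k) ((L : ℝ) ^ k) (L ^ (d * k)) (H - H') ≤ omegaABKM d R A A𝒫 r := by
    unfold omegaABKM vABKM
    have e7 : 8 * Real.exp (1 / 4) * r ≤ 8 * Real.exp (1 / 4) * (2 * r + pi2BoundConst d (((2 * R + 2 : ℕ) : ℝ) + ((d / 2 + 1 : ℕ) : ℝ)) * (r * A𝒫 * A⁻¹)) := by nlinarith [he14, hr0, hv0]
    nlinarith [e5, e7, he38, hr0, hv0]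
  have hω3 : r + CΔ ≤ omegaABKM d R A A𝒫 r := by
    unfold omegaABKM vABKM
    nlinarith [e6, hCΔ2, hr0, hv0, he38]
  have hκ1 : 1 + Real.exp (1 / 4) + 16 * Real.exp (3 / 8) * (2 * hamNorm (fieldWt h (L : ℝ) d k) ((L : ℝ) ^ k) (L ^ (d * k)) (H - H') + pi2BoundConst d (((2 * R + 2 : ℕ) : ℝ) + ((d / 2 + 1 : ℕ) : ℝ)) * (CΔ * A𝒫 * A⁻¹)) ≤ kappaABKM d R A A𝒫 r := by
    unfold kappaABKM vABKM; linarith [e2]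
  have hκ2 : 1 + Real.exp (1 / 4) + 16 * Real.exp (3 / 8) * (2 * r + pi2BoundConst d (((2 * R + 2 : ℕ) : ℝ) + ((d / 2 + 1 : ℕ) : ℝ)) * (r * A𝒫 * A⁻¹)) ≤ kappaABKM d R A A𝒫 r := by
    unfold kappaABKM vABKM; linarith [e4]
  exact weakNormLE_nextKStep_sub_abkm_max_gain hd hn hLodd hL hR2 hM hkN hp hpM hMR hr₀ hθbar hlam hB hδ₀ hδ₁ hh hh0 hCα
    hh2 hA𝒫 hA1 hA𝒫A hsmall D hDs hDL hD𝒞 hB₀ hc₀ hH hH' hr hr0 hCΔ hK hK' hΔ hKfac hK0 hK'fac hK'0 hKd hK'd hKloc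
    hK'loc hKt hK't hv' hω1 hω2 hω3 hωA hκ1 hκ2 hc3A hc2A hCΔ2

set_option maxHeartbeats 400000 in
/-- **`‖S(H,K)‖_{k+1}^{(A)} ≤ σ(r)·r` on the `r`-ball** (module docstring): the Lipschitz estimate against the
origin `(H', K') = (0, 𝟙_∅)`, where `S(0, 𝟙_∅) = 𝟙_∅` vanishes on non-empty polymers.
[cite: AdamsBuchholzKoteckyMuller2019, Theorem 6.8 / Ch. 12 (12.47)] -/
theorem weakNormLE_nextKStep_abkm_ball {L N Mord R n p r₀ : ℕ} {θbar lam μ δ₁ δ₀ A𝒫 h A : ℝ}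
    {𝒞 : ℕ → (Fin d → ZMod M) → ℝ} (hd : 3 ≤ d) (hn : 2 ≤ n) (hLodd : Odd L) (hL : 2 ^ (d + 3) + 16 * R ≤ L)
    (hR2 : 2 ≤ R) (hM : M = L ^ N) {k : ℕ} (hkN : k + 1 ≤ N)
    (hp : d / 2 + 2 ≤ p) (hpM : p + d ≤ Mord) (hMR : Mord ≤ R) (hr₀ : 3 ≤ r₀)
    (hθbar : 0 < θbar) (hlam : 0 < lam)
    (hB : AbkmWeightBounds L N Mord R n θbar lam μ δ₁ δ₀ A𝒫 𝒞
      (abkmWeightData L N Mord R θbar (schedDelta δ₀ δ₁ N) 𝒞))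
    (hδ₀ : 0 < δ₀) (hδ₁ : 0 < δ₁) (hh : 0 < h) (hh0 : hZeroSq d R δ₀ δ₁ ≤ h ^ 2)
    {Cα : (Fin d → ℕ) → ℝ}
    (hCα : ∀ j, 1 ≤ j → j ≤ N + 1 → ∀ θ' : Fin d → ℕ, ∑ i, θ' i ≤ n →
      ∀ x, |iterDiff θ' (𝒞 j) x| ≤ Cα θ' / (L : ℝ) ^ ((j - 1) * (d - 2 + ∑ i, θ' i)))
    (hh2 : secondDiffConst Cα ≤ h ^ 2) (hA𝒫 : 0 ≤ A𝒫) (hA1 : 1 ≤ A)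
    (hA𝒫A : A𝒫 ≤ A)
    (hsmall : (2 : ℝ) ^ (L ^ d) * (A𝒫 * A ^ (-(1 - (1 + 1 / ((2 * (2 ^ d + 1) + 6 : ℝ) ^ d))⁻¹) : ℝ)) ≤ 1)
    (D : StepData d M) (hDs : D.s = L ^ k) (hDL : D.L = L) (hD𝒞 : D.𝒞 = 𝒞 (k + 1))
    {x₀ : Fin d → ZMod M} (hB₀ : D.B₀ = blockOf (L ^ k) x₀) (hc₀ : D.c₀ = boxCorner (L ^ k) (starRad R L d k) x₀)
    {H : RelevantHamiltonian ℂ d} {r : ℝ}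
    (hH : hamNorm (fieldWt h (L : ℝ) d k) ((L : ℝ) ^ k) (L ^ (d * k)) H ≤ r) (hr : r ≤ 1 / 64)
    {K : Finset (Fin d → ZMod M) → ((Fin d → ZMod M) → ℝ) → ℂ}
    (hK : WeakNormLE (abkmNormParams L N Mord R p r₀ h θbar A (schedDelta δ₀ δ₁ N) 𝒞) k K r)
    (hKfac : Factorises (L ^ k) K) (hK0 : ∀ φ, K ∅ φ = 1)
    (hKd : ∀ Y, ContDiff ℝ r₀ (K Y))
    (hKloc : ∀ Y, IsPolymer (L ^ k) Y → IsConn Y → IsGaugeLocal ((abkmNormParams L N Mord R p r₀ h θbar A (schedDelta δ₀ δ₁ N) 𝒞).gauge k Y) (K Y))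
    (hKt : TransInv (L ^ k) K)
    (hv : vABKM d R A A𝒫 r ≤ 1 / 64) (hωA : omegaABKM d R A A𝒫 r * A ^ 2 ≤ 1)
    (hc3A : (kappaABKM d R A A𝒫 r) ^ (L ^ d) * ((2 * (2 * (kappaABKM d R A A𝒫 r) * max 1 A𝒫)) ^ ((2 ^ (d + 1) + 2) ^ d * L ^ d) * (4 : ℝ) ^ ((2 ^ (d + 1) + 2) ^ d * L ^ d)) ≤ A ^ ((1 + 1 / ((2 * (2 ^ d + 1) + 6 : ℝ) ^ d)) - 1 : ℝ))
    (hc2A : (kappaABKM d R A A𝒫 r) ^ (L ^ d) * ((2 * (kappaABKM d R A A𝒫 r) * max 1 A𝒫) ^ ((2 ^ (d + 1) + 2) ^ d * L ^ d) * (2 : ℝ) ^ ((2 ^ (d + 1) + 2) ^ d * L ^ d)) ≤ A ^ ((1 + 1 / ((2 * (2 ^ d + 1) + 6 : ℝ) ^ d)) - 1 : ℝ)) :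
    WeakNormLE (abkmNormParams L N Mord R p r₀ h θbar A (schedDelta δ₀ δ₁ N) 𝒞) (k + 1) (nextKStep D H K) (sigmaABKM d L R A A𝒫 r * r) := by
  have hL0 : (0 : ℝ) < L := by exact_mod_cast hLodd.pos
  have hA0 : 0 < A := by linarith
  have hPA : 0 < (abkmNormParams L N Mord R p r₀ h θbar A (schedDelta δ₀ δ₁ N) 𝒞).A := hA0
  have h𝔥 : 0 < fieldWt h (L : ℝ) d k := fieldWt_pos hh hL0 d k
  have hRk : (0 : ℝ) < (L : ℝ) ^ k := by positivity
  have hr0 : 0 ≤ r := (hamNorm_nonneg h𝔥.le hRk.le _ _).trans hH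
  have hk1 : 1 ≤ L ^ k := Nat.one_le_pow _ _ hLodd.pos
  have hH' : hamNorm (fieldWt h (L : ℝ) d k) ((L : ℝ) ^ k) (L ^ (d * k)) (0 : RelevantHamiltonian ℂ d) ≤ r := by rw [hamNorm_zero]; exact hr0
  have hK' : WeakNormLE (abkmNormParams L N Mord R p r₀ h θbar A (schedDelta δ₀ δ₁ N) 𝒞) k trivAct r := weakNormLE_trivAct hPA k hr0
  have hΔ : WeakNormLE (abkmNormParams L N Mord R p r₀ h θbar A (schedDelta δ₀ δ₁ N) 𝒞) k (K - trivAct) r := weakNormLE_sub_trivAct hK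
  have hCΔ2 : r ≤ 2 * r := by linarith
  have h := weakNormLE_nextKStep_sub_abkm_ball hd hn hLodd hL hR2 hM hkN hp hpM hMR hr₀ hθbar hlam hB hδ₀ hδ₁ hh hh0 hCα
    hh2 hA𝒫 hA1 hA𝒫A hsmall D hDs hDL hD𝒞 hB₀ hc₀ hH hH' hr hr0 hK hK' hΔ hCΔ2 hKfac hK0 (factorises_trivAct hk1)
    (fun φ => by rw [trivAct_apply, TorusPolymer.punit_empty]) hKd (contDiff_trivAct r₀) hKloc
    (fun Y _ _ => isGaugeLocal_trivAct _ Y) hKt (transInv_trivAct (L ^ k)) hv hωA hc3A hc2A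
  have hB0ne : D.B₀ ≠ ∅ := by rw [hB₀]; exact Finset.ne_empty_of_mem (mem_blockOf_self (L ^ k) x₀)
  intro U hU hUc
  have hUne : U ≠ ∅ := Finset.nonempty_iff_ne_empty.1 hUc.1
  have hfun : (fun φ => nextKStep D H K U φ - nextKStep D 0 trivAct U φ) = nextKStep D H K U := by
    funext φ
    rw [nextKStep_zero_trivAct D hB0ne U φ]
    unfold TorusPolymer.punit
    rw [if_neg hUne, sub_zero]
  have hU := h U hU hUc
  dsimp only at hU
  rw [hfun, sub_zero, max_eq_right hH] at hU
  exact hU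

end Literature.MathematicalPhysics.StatisticalMechanics.GradientRG

end
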